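import Literature.AlgebraicGeometry.ModuliOfAbelianVarieties.SiegelFamilyNoetherLefschetzTwistedProduct
import Literature.Geometry.Kaehler.ComplexTorusAntisymplecticIsomorphismOfTypes
import HarnessLib

/-!
# Debarre's morphism `𝒫_{g,δ} : 𝒜_{u,δ} × 𝒜_{g−u,δ̃} → NL_{g,δ}` is defined on every pair of the complementary
# types (Iribar López 2024, Definition 4 with Lemma 10, read on `𝔥_g`)

Layer `Literature/AlgebraicGeometry/ModuliOfAbelianVarieties`, namespace
`Literature.AlgebraicGeometry.ModuliOfAbelianVarieties.SiegelModuli`; lane `lit-hodgefound` (Track 2 foundations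
library, Layer A4), seat `lit-hodgefound-skel-4` (gen 26), row **A4-76**, FILE G.  Sequel of
`SiegelFamilyNoetherLefschetzTwistedProduct.lean` (FILE C: a twisted product `((Y × Z)/graph(p), θ_p)` for a
GIVEN bijective antisymplectic `p : K(θ_Y) → K(θ_Z)` is, as a polarised torus, a member `(X_W, E_W)` of the
principal Siegel family with `W ∈ NL_{g,δ} ∩ NL_{g,δ̃}`) and of the Kähler-layer
`ComplexTorusAntisymplecticIsomorphismOfTypes.lean` (FILE F: such a `p` EXISTS for every `(Y, θ_Y)` of type
`δ = (d₁, …, d_u)` and `(Z, θ_Z)` of the complementary type `δ̃ = (1, …, 1, d₁, …, d_u)` — Iribar López's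
`f_Z ∘ r ∘ f_Y⁻¹`).

## What is here

Iribar López [§2.2 Def. 4, p. 8]: «If `u ≤ g/2` and `δ = (d₁, …, d_u)` is a polarization type, define the morphism
`𝒫_{g,δ} : 𝒜^{lev}_{u,δ} × 𝒜^{lev}_{g−u,δ̃} → 𝒜_g` sending the pair `((Y, θ_Y, f_Y), (Z, θ_Z, f_Z))` to
`((Y × Z)/graph(f_Z ∘ r ∘ f_Y⁻¹), θ_{f_Z ∘ r ∘ f_Y⁻¹})` … By Lemma 10, `𝒫_{g,δ}` is surjective onto the locus of
principally polarized abelian varieties having a subvariety whose induced type is of type `δ`.»  On the period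
domain `𝔥_g` (tree `nlLocusType g δ`):

* `exists_mem_nlLocusType_isPolarizedIso_quotientBy_graphSubgroup_of_isPolarizationType_append` (§1): for EVERY
  polarised torus `(Y, ω₁)` of type `δ` and EVERY `(Z, ω₂)` of type `δ̃ = (1^k, δ)` with `rk Λ_Y + rk Λ_Z = 2g`
  there are a bijective antisymplectic `p : K(L₁) → K(L₂)`, a point `W ∈ 𝔥_g` and an isomorphism of polarised
  tori `((Y × Z)/graph(p), θ_p) ≅ (X_W, E_W)`, and `W ∈ NL_{g,δ} ∩ NL_{g,δ̃}` — the value `𝒫_{g,δ}((Y, θ_Y), (Z, θ_Z))`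
  exists for every pair of the domain `𝒜_{u,δ} × 𝒜_{g−u,δ̃}` and lies in `NL_{g,δ}` (FILE F's `p` fed to FILE C);
  the equal-type case `…_of_isPolarizationType_eq` (`g = 2u`, Remark 11);
* `add_add_eq_of_isPolarizationType_append` (§1): the dimension bookkeeping `u + (k + u) = g`, i.e. `k = g − 2u`;
* `exists_mem_humbertLocusPrim_sq_isPolarizedIso_quotientBy_graphSubgroup` (§2, validation `g = 2`): for ANY two
  polarised tori `(E₁, ω₁)`, `(E₂, ω₂)` of rank `2` and type `(d)` there are an antisymplectic
  `p : E₁[ω₁] ≅ E₂[ω₂]` and a point `W` of the Humbert surface `H_{d²}` with `(E₁ × E₂)/graph(p) ≅ X_W` as polarised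
  tori (`NL_{2,(d)} = H_{d²}`, row A4-74) — the classical `(d, d)`-isogeny picture of `H_{d²}`.

Not here (the remaining part of Lemma 10): «the isomorphism type of `((Y × Z)/graph(p), θ_p)` does not depend on
`p`» (the `Sp(K(δ))`-equivariance behind the factorisation `𝒫_{g,δ} = φ′ ∘ τ`).

## References

* [IribarLopez2024NoetherLefschetzCycles] A. Iribar López, *Noether–Lefschetz cycles on the moduli space of
  abelian varieties*, arXiv:2411.09910 (2024), §2.2 Lemma 10, Definition 4 and Remark 11 (pp. 7–8), §1.2 (p. 3).
* [Auffarth2016NonSimplePPAV] R. Auffarth, *A structure theorem for non-simple principally polarized abelian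
  varieties*, Math. Z. 282 (2016), §3 (`Φ_{u,n−u}(D) : 𝒜_u(D) × 𝒜_{n−u}(D̃) → 𝒜^D_{u,n−u}` is surjective).
* [Debarre1988ThetaSingulierCodim3] O. Debarre, *Sur les variétés abéliennes dont le diviseur thêta est
  singulier en codimension 3*, Duke Math. J. 57 (1988) (the original construction).
* [Kani1994EllipticCurvesAbelianSurfaces] E. Kani, *Elliptic curves on abelian surfaces*, Manuscripta Math. 84
  (1994), §1 (the Humbert surface `H_{N²}`).
-/

noncomputable section

open Matrix Module Function Set

namespace Literature.AlgebraicGeometry.ModuliOfAbelianVarieties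

namespace SiegelModuli

open Literature.NumberTheory.Automorphic (siegelUpperHalfSpace)
open Literature.NumberTheory.ModularForms.SiegelUpperHalfSpace
open Literature.Geometry.Kaehler Literature.Geometry.Kaehler.ComplexTorus

variable {g u k : ℕ}

variable {ι₁ ι₂ : Type*} [Fintype ι₁] [Fintype ι₂] [DecidableEq ι₁] [DecidableEq ι₂] {E₁ E₂ : Type*}
  [NormedAddCommGroup E₁] [NormedSpace ℂ E₁] [NormedAddCommGroup E₂] [NormedSpace ℂ E₂]
  {Φ₁ : (ι₁ → ℝ) ≃L[ℝ] E₁} {Φ₂ : (ι₂ → ℝ) ≃L[ℝ] E₂} {ω₁ : E₁ [⋀^Fin 2]→L[ℝ] ℝ} {ω₂ : E₂ [⋀^Fin 2]→L[ℝ] ℝ}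
  {G₁ : Matrix ι₁ ι₁ ℤ} {G₂ : Matrix ι₂ ι₂ ℤ}
  (hω₁ : IsRiemannForm Φ₁ ω₁) (hω₂ : IsRiemannForm Φ₂ ω₂)
  (hG₁ : G₁.map (Int.cast : ℤ → ℝ) = latticeGram Φ₁ ω₁) (hG₂ : G₂.map (Int.cast : ℤ → ℝ) = latticeGram Φ₂ ω₂)

/-! ## §1 `𝒫_{g,δ}` is defined on every pair `((Y, θ_Y), (Z, θ_Z))` of types `δ`, `δ̃` and lands in
`NL_{g,δ} ∩ NL_{g,δ̃}` -/

include hω₁ hω₂ hG₁ hG₂ in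
/-- **Iribar López 2024, Def. 4 with Lemma 10, on `𝔥_g`: `𝒫_{g,δ}((Y, θ_Y), (Z, θ_Z)) ∈ NL_{g,δ} ∩ NL_{g,δ̃}` for
EVERY pair of the complementary types.**  For polarised tori `(Y, ω₁)` of type `δ = (d₁, …, d_u)` and `(Z, ω₂)` of
type `δ̃ = (1^k, δ)` with `rk Λ_Y + rk Λ_Z = 2g` there are a bijective antisymplectic `p : K(L₁) → K(L₂)` (FILE F:
`f_Z ∘ r ∘ f_Y⁻¹`), so that `(Y × Z)/graph(p)` is principally polarised by the descended `ω₁ ⊠ ω₂` (FILE A), a point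
`W ∈ 𝔥_g` and an isomorphism of polarised tori `((Y × Z)/graph(p), θ_p) ≅ (X_W, E_W)` (Thm. 3.1.2), and every such
`W` lies in `NL_{g,δ}` and in `NL_{g,δ̃}` (FILE C). [cite: IribarLopez2024NoetherLefschetzCycles, §2.2 Def. 4 and Lemma 10 (pp. 7–8)] [cite: Auffarth2016NonSimplePPAV, §3 (`Φ_{u,n−u}(D)`)] [cite: Debarre1988ThetaSingulierCodim3, (the original construction)] -/
theorem exists_mem_nlLocusType_isPolarizedIso_quotientBy_graphSubgroup_of_isPolarizationType_append
    (hg : Fintype.card ι₁ + Fintype.card ι₂ = 2 * g) {δ : Fin u → ℕ} (hδ : ComplexTorus.IsPolarizationType Φ₁ ω₁ δ)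
    (hδ' : ComplexTorus.IsPolarizationType Φ₂ ω₂ (Fin.append (fun _ : Fin k ↦ 1) δ)) :
    ∃ (p : kerPhiH Φ₁ G₁ →+ kerPhiH Φ₂ G₂) (_ : Bijective p) (_ : IsAntisymplectic ω₁ ω₂ p)
      (_ : Finite (graphSubgroup (kerPhiH Φ₁ G₁) (kerPhiH Φ₂ G₂) p))
      (_ : IsPrincipalPolarization (quotientByPeriod (prodPeriod Φ₁ Φ₂) (graphSubgroup (kerPhiH Φ₁ G₁) (kerPhiH Φ₂ G₂) p))
        (prodForm ω₁ ω₂))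
      (W : siegelUpperHalfSpace g)
      (h : ComplexTorus (quotientByPeriod (prodPeriod Φ₁ Φ₂) (graphSubgroup (kerPhiH Φ₁ G₁) (kerPhiH Φ₂ G₂) p)) ≃+
        ComplexTorus (prinPeriod W : (Fin g ⊕ Fin g → ℝ) ≃L[ℝ] (Fin g → ℂ))),
      IsPolarizedIso (quotientByPeriod (prodPeriod Φ₁ Φ₂) (graphSubgroup (kerPhiH Φ₁ G₁) (kerPhiH Φ₂ G₂) p))
          (prodForm ω₁ ω₂) (prinPeriod W : (Fin g ⊕ Fin g → ℝ) ≃L[ℝ] (Fin g → ℂ)) (prinForm W) h ∧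
        W ∈ nlLocusType g δ ∧ W ∈ nlLocusType g (Fin.append (fun _ : Fin k ↦ 1) δ) := by
  obtain ⟨p, hp, ha, hfin, hP⟩ :=
    hδ.exists_isPrincipalPolarization_quotientBy_graphSubgroup_append hω₁ hω₂ hG₁ hG₂ hδ'
  haveI := hfin
  obtain ⟨W, h, hh, h₁, h₂⟩ :=
    exists_mem_nlLocusType_isPolarizedIso_quotientBy_graphSubgroup hω₁ hω₂ hG₁ hG₂ hp ha hg hδ hδ'
  exact ⟨p, hp, ha, hfin, hP, W, h, hh, h₁, h₂⟩

include hω₁ hω₂ hG₁ hG₂ in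
/-- **The equal-type case** (`δ̃ = δ`, `g = 2u`): for `(Y, ω₁)`, `(Z, ω₂)` both of type `δ` with
`rk Λ_Y + rk Λ_Z = 2g` there are a bijective antisymplectic `p`, a point `W ∈ NL_{g,δ}` and
`((Y × Z)/graph(p), θ_p) ≅ (X_W, E_W)`. [cite: IribarLopez2024NoetherLefschetzCycles, §2.2 Def. 4, Lemma 10 and Remark 11 (p. 8)] -/
theorem exists_mem_nlLocusType_isPolarizedIso_quotientBy_graphSubgroup_of_isPolarizationType_eq
    (hg : Fintype.card ι₁ + Fintype.card ι₂ = 2 * g) {δ : Fin u → ℕ} (hδ : ComplexTorus.IsPolarizationType Φ₁ ω₁ δ)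
    (hδ' : ComplexTorus.IsPolarizationType Φ₂ ω₂ δ) :
    ∃ (p : kerPhiH Φ₁ G₁ →+ kerPhiH Φ₂ G₂) (_ : Bijective p) (_ : IsAntisymplectic ω₁ ω₂ p)
      (_ : Finite (graphSubgroup (kerPhiH Φ₁ G₁) (kerPhiH Φ₂ G₂) p))
      (_ : IsPrincipalPolarization (quotientByPeriod (prodPeriod Φ₁ Φ₂) (graphSubgroup (kerPhiH Φ₁ G₁) (kerPhiH Φ₂ G₂) p))
        (prodForm ω₁ ω₂))
      (W : siegelUpperHalfSpace g)
      (h : ComplexTorus (quotientByPeriod (prodPeriod Φ₁ Φ₂) (graphSubgroup (kerPhiH Φ₁ G₁) (kerPhiH Φ₂ G₂) p)) ≃+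
        ComplexTorus (prinPeriod W : (Fin g ⊕ Fin g → ℝ) ≃L[ℝ] (Fin g → ℂ))),
      IsPolarizedIso (quotientByPeriod (prodPeriod Φ₁ Φ₂) (graphSubgroup (kerPhiH Φ₁ G₁) (kerPhiH Φ₂ G₂) p))
          (prodForm ω₁ ω₂) (prinPeriod W : (Fin g ⊕ Fin g → ℝ) ≃L[ℝ] (Fin g → ℂ)) (prinForm W) h ∧
        W ∈ nlLocusType g δ := by
  obtain ⟨p, hp, ha, hfin, hP⟩ :=
    hδ.exists_isPrincipalPolarization_quotientBy_graphSubgroup_of_eq hω₁ hω₂ hG₁ hG₂ hδ'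
  haveI := hfin
  obtain ⟨W, h, hh, h₁, -⟩ :=
    exists_mem_nlLocusType_isPolarizedIso_quotientBy_graphSubgroup hω₁ hω₂ hG₁ hG₂ hp ha hg hδ hδ'
  exact ⟨p, hp, ha, hfin, hP, W, h, hh, h₁⟩

omit [DecidableEq ι₁] [DecidableEq ι₂] in
/-- The dimension bookkeeping of the domain of `𝒫_{g,δ}`: `u + (k + u) = g`, i.e. `k = g − 2u` ones in `δ̃`
(`dim Y = u`, `dim Z = g − u`). [cite: IribarLopez2024NoetherLefschetzCycles, §2.2 (p. 7: «It has dimension `g − u`», `δ̃ = (1, …, 1 (g − 2u times), d₁, …, d_u)`)] -/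
theorem add_add_eq_of_isPolarizationType_append (hg : Fintype.card ι₁ + Fintype.card ι₂ = 2 * g) {δ : Fin u → ℕ}
    (hδ : ComplexTorus.IsPolarizationType Φ₁ ω₁ δ)
    (hδ' : ComplexTorus.IsPolarizationType Φ₂ ω₂ (Fin.append (fun _ : Fin k ↦ 1) δ)) : u + (k + u) = g :=
  add_eq_of_isPolarizationType hg hδ hδ'

/-! ## §2 Validation (`g = 2`): any two elliptic curves with degree-`d` polarisations give a point of the Humbert
surface `H_{d²}` -/

include hω₁ hω₂ hG₁ hG₂ in
/-- **`(E₁ × E₂)/graph(p) ∈ H_{d²}` for ANY two polarised tori of rank `2` and type `(d)`**: there are an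
antisymplectic `p : E₁[ω₁] ≅ E₂[ω₂]` (FILE F, equal types), a point `W` of the Humbert surface `H_{d²} = NL_{2,(d)}`
(row A4-74) and an isomorphism of polarised tori `((E₁ × E₂)/graph(p), θ_p) ≅ (X_W, E_W)` — the `(d, d)`-isogeny
`E₁ × E₂ → X_W` of degree `d²` of the classical description of `H_{d²}`.
[cite: IribarLopez2024NoetherLefschetzCycles, §1.2 (p. 4: «When `g = 2` … Humbert surfaces») and §2.2 Def. 4, Remark 11] [cite: Kani1994EllipticCurvesAbelianSurfaces, §1 (`H_{N²}`)] -/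
theorem exists_mem_humbertLocusPrim_sq_isPolarizedIso_quotientBy_graphSubgroup
    (hg : Fintype.card ι₁ + Fintype.card ι₂ = 2 * 2) {d : ℕ} (hδ : ComplexTorus.IsPolarizationType Φ₁ ω₁ ![d])
    (hδ' : ComplexTorus.IsPolarizationType Φ₂ ω₂ ![d]) :
    ∃ (p : kerPhiH Φ₁ G₁ →+ kerPhiH Φ₂ G₂) (_ : Bijective p) (_ : IsAntisymplectic ω₁ ω₂ p)
      (_ : Finite (graphSubgroup (kerPhiH Φ₁ G₁) (kerPhiH Φ₂ G₂) p))
      (W : siegelUpperHalfSpace 2)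
      (h : ComplexTorus (quotientByPeriod (prodPeriod Φ₁ Φ₂) (graphSubgroup (kerPhiH Φ₁ G₁) (kerPhiH Φ₂ G₂) p)) ≃+
        ComplexTorus (prinPeriod W : (Fin 2 ⊕ Fin 2 → ℝ) ≃L[ℝ] (Fin 2 → ℂ))),
      IsPolarizedIso (quotientByPeriod (prodPeriod Φ₁ Φ₂) (graphSubgroup (kerPhiH Φ₁ G₁) (kerPhiH Φ₂ G₂) p))
          (prodForm ω₁ ω₂) (prinPeriod W : (Fin 2 ⊕ Fin 2 → ℝ) ≃L[ℝ] (Fin 2 → ℂ)) (prinForm W) h ∧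
        W ∈ humbertLocusPrim ((d : ℤ) ^ 2) := by
  obtain ⟨p, hp, ha, hfin, -, W, h, hh, hW⟩ :=
    exists_mem_nlLocusType_isPolarizedIso_quotientBy_graphSubgroup_of_isPolarizationType_eq hω₁ hω₂ hG₁ hG₂ hg hδ hδ'
  have hd : 0 < d := hδ.pos hω₁ 0
  rw [nlLocusType_two_eq_humbertLocusPrim_sq hd] at hW
  exact ⟨p, hp, ha, hfin, W, h, hh, hW⟩

end SiegelModuli

end Literature.AlgebraicGeometry.ModuliOfAbelianVarieties

end
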